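import Literature.Barriers.NavierStokesRegularity.SchefferSwitchedSolution
import HarnessLib

/-!
# Scheffer's switched field: Type I rates, scale-invariant `L³` bound and the energy jump

Barrier-catalogue support file for `NavierStokesRegularity` (D-0021), written for the barrier
AUDIT of `NavierStokesInequalitySwitching` / `NavierStokesInequalitySingularSolutions`: it
certifies, for EVERY classical block `(T, ν₀, τ, z, G, u)` (`IsNSIBlock`), three structural
features of Scheffer's glued field `𝔲 = Scheffer.glue T τ z u` (Scheffer 1985, Lemma 2.3;
W. S. Ożański, arXiv:1709.00602, §2) that delimit what the barrier does and does not cover: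

* **Type I rates** (Ożański 2017, §2.1, p. 6: `𝔲` is discretely self-similar about `(x₀, T₀)`
  with factor `τ`, "the property characteristic for the Leray hypothetical self-focusing strong
  solutions … except that here the self-similarity holds only for the discrete scaling factors
  `τʲ`"): `‖𝔲(t, x)‖ ≤ C (T₀ - t)^{-1/2}` for all `t < T₀` (`norm_glue_le_div_sqrt`;
  so the singular time `T₀` (`isSingularTime_glue`) is a Type I and not a Type II blow-up in the
  sense of the accepted `Literature.Analysis.FluidPDE.IsTypeIBlowup` / `IsTypeIIBlowup`,
  `not_isTypeIIBlowup_glue`) and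
  `‖x - x₀‖ ‖𝔲(t, x)‖ ≤ C` for all `t, x` (`norm_sub_mul_norm_glue_le`);
* **the scale-invariant `L³` norm stays bounded** (Ożański 2017, §2.1, p. 7: "the `L³` norm of
  `𝔲(t)` remains bounded by `sup_{t ∈ [0,T]} ‖u^{(0)}(t)‖_{L³}`. This shows that the `L_{3,∞}`
  regularity criterion uses, in an essential way, properties of solutions of the Navier–Stokes
  equations (rather than merely the Navier–Stokes inequality)"):
  `∫ |𝔲(s)|³ = ∫ |u(σ)|³` on each piece and `sup_s ∫|𝔲(s)|³ < ∞`
  (`lintegral_norm_glue_cube_eq`, `lintegral_norm_glue_cube_le`);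
* **the energy jumps at the first switching time** (Ożański 2017, §2, (2.6) and the energy
  inequality (2.7) of §2.1; Scheffer 1985, (2.33)): `∫|𝔲(T)|² = τ ∫|u(0)|² < ∫|u(T)|²`, the
  strict inequality because `supp u(T) = G ⊋ Γ(G) ⊇ supp 𝔲(T)` (`lintegral_norm_sq_glue_T`,
  `lintegral_norm_sq_glue_T_lt`), while `∫|𝔲(t)|² → ∫|u(T)|²` as `t ↑ T`
  (`tendsto_lintegral_norm_sq_glue_left`): the energy `t ↦ ‖𝔲(t)‖²_{L²}` is NOT left-continuous
  at `T` (`not_continuousWithinAt_energy_glue`). In particular the switched field is not in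
  `C([0,T₀); L²)`: the switching mechanism, as printed, never produces time-continuous examples.

Everything here is PROVED from the accepted API of `SchefferSwitchedField/Pieces/Strips/
Integrability/Singular`; no facts are introduced.

## References

* W. S. Ożański, *On weak solutions to the Navier–Stokes inequality with internal
  singularities*, arXiv:1709.00602 (2017), §2 and §2.1 (pp. 6–7). [`Ozanski2017NSISingular`]
* V. Scheffer, Comm. Math. Phys. 101 (1985), 47–85, Lemma 2.3, (2.33). [`Scheffer1985`]
* J. Leray, Acta Math. 63 (1934), (3.12). [`Leray1934`]
* L. Escauriaza, G. Seregin, V. Šverák, Russ. Math. Surveys 58 (2003). [`EscauriazaSereginSverak2003`]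
-/

noncomputable section

open MeasureTheory Set Function Filter Topology TopologicalSpace Metric Module
open scoped ENNReal InnerProductSpace RealInnerProductSpace ContDiff

namespace Literature.Barriers.NavierStokesRegularity

namespace IsNSIBlock

open Scheffer Literature.Analysis.FluidPDE

variable {T ν₀ τ : ℝ} {z : EuclideanSpace ℝ (Fin 3)} {G : Set (EuclideanSpace ℝ (Fin 3))}
  {u : ℝ → EuclideanSpace ℝ (Fin 3) → EuclideanSpace ℝ (Fin 3)}

/-! ### Pointwise size of the pieces -/

/-- `τ² ≠ 1`. [folklore] -/
theorem sq_ne_one (h : IsNSIBlock T ν₀ τ z G u) : τ ^ 2 ≠ 1 :=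
  (pow_lt_one₀ h.τ_pos.le h.τ_lt_one two_ne_zero).ne

/-- **On the `j`-th piece the glued field has size `≤ τ^{-j} sup|u|`.**
[cite: Ozanski2017NSISingular, §2 (2.4)] -/
theorem norm_glue_le_of_mem_Ico (h : IsNSIBlock T ν₀ τ z G u) {M : ℝ}
    (hM : ∀ t ∈ Icc 0 T, ∀ x, ‖u t x‖ ≤ M) {t : ℝ} {j : ℕ}
    (hj : t ∈ Ico (switchTime T τ j) (switchTime T τ (j + 1))) (x : EuclideanSpace ℝ (Fin 3)) :
    ‖glue T τ z u t x‖ ≤ (τ⁻¹) ^ j * M := by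
  rw [glue_apply_of_mem_Ico h.T_pos h.τ_pos z u hj, norm_smul,
    Real.norm_of_nonneg (h.inv_tau_pow_pos j).le]
  exact mul_le_mul_of_nonneg_left
    (hM _ (localTime_mem_Icc h.τ_pos (Ico_subset_Icc_self hj)) _) (h.inv_tau_pow_pos j).le

/-- On the `j`-th piece, `τ^{-j} √(T₀ - t) ≤ √T₀` (`T₀ - t ≤ T₀ - t_j = τ^{2j} T₀`). [folklore] -/
theorem inv_pow_mul_sqrt_le (h : IsNSIBlock T ν₀ τ z G u) {t : ℝ} {j : ℕ}
    (hj : t ∈ Ico (switchTime T τ j) (switchTime T τ (j + 1))) :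
    (τ⁻¹) ^ j * Real.sqrt (blowupTime T τ - t) ≤ Real.sqrt (blowupTime T τ) := by
  have hrem : blowupTime T τ - t ≤ τ ^ (2 * j) * blowupTime T τ := by
    rw [← blowupTime_sub_switchTime T h.sq_ne_one j]
    linarith [hj.1]
  have h1 : Real.sqrt (blowupTime T τ - t) ≤ τ ^ j * Real.sqrt (blowupTime T τ) := by
    calc Real.sqrt (blowupTime T τ - t) ≤ Real.sqrt (τ ^ (2 * j) * blowupTime T τ) :=
          Real.sqrt_le_sqrt hrem
      _ = τ ^ j * Real.sqrt (blowupTime T τ) := by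
          rw [Real.sqrt_mul' _ h.blowupTime_pos.le, pow_mul', Real.sqrt_sq (pow_nonneg h.τ_pos.le _)]
  calc (τ⁻¹) ^ j * Real.sqrt (blowupTime T τ - t)
      ≤ (τ⁻¹) ^ j * (τ ^ j * Real.sqrt (blowupTime T τ)) :=
        mul_le_mul_of_nonneg_left h1 (h.inv_tau_pow_pos j).le
    _ = Real.sqrt (blowupTime T τ) := by
        rw [← mul_assoc, ← mul_pow, inv_mul_cancel₀ h.τ_pos.ne', one_pow, one_mul]

/-! ### Type I rate in time -/

/-- **Type I rate in time**: `‖𝔲(t, x)‖ ≤ C/√(T₀ - t)` for all `t < T₀` and all `x`, with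
`C = sup|u| · √T₀` (discrete self-similarity about `(x₀, T₀)`, Ożański 2017, §2.1 p. 6; the rate
of Leray's hypothetical self-similar blow-up, Acta Math. 63 (1934), (3.12)).
[cite: Ozanski2017NSISingular, §2.1 (p. 6)] -/
theorem norm_glue_le_div_sqrt (h : IsNSIBlock T ν₀ τ z G u) :
    ∃ C : ℝ, 0 ≤ C ∧ ∀ t < blowupTime T τ, ∀ x : EuclideanSpace ℝ (Fin 3),
      ‖glue T τ z u t x‖ ≤ C / Real.sqrt (blowupTime T τ - t) := by
  obtain ⟨M, hM0, hM⟩ := h.exists_bound_norm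
  refine ⟨M * Real.sqrt (blowupTime T τ), by positivity, fun t ht x => ?_⟩
  have hsq : 0 < Real.sqrt (blowupTime T τ - t) := Real.sqrt_pos.2 (sub_pos.2 ht)
  rw [le_div_iff₀ hsq]
  by_cases ht0 : 0 ≤ t
  · obtain ⟨j, hj⟩ := exists_mem_Ico_switchTime h.τ_pos h.τ_lt_one ht0 ht
    calc ‖glue T τ z u t x‖ * Real.sqrt (blowupTime T τ - t)
        ≤ (τ⁻¹) ^ j * M * Real.sqrt (blowupTime T τ - t) :=
          mul_le_mul_of_nonneg_right (h.norm_glue_le_of_mem_Ico hM hj x) hsq.le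
      _ = M * ((τ⁻¹) ^ j * Real.sqrt (blowupTime T τ - t)) := by ring
      _ ≤ M * Real.sqrt (blowupTime T τ) := mul_le_mul_of_nonneg_left (h.inv_pow_mul_sqrt_le hj) hM0
  · rw [glue_eq_zero_of_neg h.T_pos h.τ_pos z u (not_le.1 ht0)]
    simp only [Pi.zero_apply, norm_zero, zero_mul]
    positivity

/-- `T₀` is a singular time of the switched field (the blow-up point `(T₀, x₀)` is singular,
`not_isRegularPoint_glue`). [cite: Ozanski2017NSISingular, §2 (p. 6)] -/
theorem isSingularTime_glue (h : IsNSIBlock T ν₀ τ z G u) :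
    IsSingularTime (glue T τ z u) (blowupTime T τ) :=
  ⟨blowupPoint τ z, h.not_isRegularPoint_glue⟩

/-- **The blow-up at `T₀` is of Type I, not of Type II**, in the sense of the accepted
`Literature.Analysis.FluidPDE.IsTypeIBlowup` / `IsTypeIIBlowup` (the `IsTypeIBlowup` packaging of
`norm_glue_le_div_sqrt` is also recorded Summits-side as
`Summit.NavierStokesRegularity.NavierStokesRegularity.Theorems.Target.Negative.isTypeIBlowup_glue`).
[cite: Ozanski2017NSISingular, §2.1 (p. 6)] -/
theorem not_isTypeIIBlowup_glue (h : IsNSIBlock T ν₀ τ z G u) :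
    ¬ IsTypeIIBlowup (glue T τ z u) (blowupTime T τ) := by
  obtain ⟨C, -, hC⟩ := h.norm_glue_le_div_sqrt
  exact fun hII => hII.2 ⟨C, eventually_nhdsWithin_of_forall fun t ht => hC t ht⟩

/-! ### Type I rate in space -/

/-- **Type I rate in space**: `‖x - x₀‖ · ‖𝔲(t, x)‖ ≤ C` for all `t` and `x`
(`supp u^{(j)}(t) ⊆ Γʲ(G) ⊆ B(x₀, τʲ R)` while `|u^{(j)}| ≤ τ^{-j} sup|u|`).
[cite: Ozanski2017NSISingular, §2 (2.4)–(2.5) and §2.1 (p. 6)] -/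
theorem norm_sub_mul_norm_glue_le (h : IsNSIBlock T ν₀ τ z G u) :
    ∃ C : ℝ, 0 ≤ C ∧ ∀ (t : ℝ) (x : EuclideanSpace ℝ (Fin 3)),
      ‖x - blowupPoint τ z‖ * ‖glue T τ z u t x‖ ≤ C := by
  obtain ⟨M, hM0, hM⟩ := h.exists_bound_norm
  obtain ⟨R₀, hR₀pos, hR₀⟩ := h.isCompact.isBounded.exists_pos_norm_le
  have hR0 : 0 ≤ R₀ + ‖blowupPoint τ z‖ := by positivity
  have hRG : ∀ y ∈ G, ‖y - blowupPoint τ z‖ ≤ R₀ + ‖blowupPoint τ z‖ := by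
    intro y hy
    calc ‖y - blowupPoint τ z‖ ≤ ‖y‖ + ‖blowupPoint τ z‖ := norm_sub_le y (blowupPoint τ z)
      _ ≤ R₀ + ‖blowupPoint τ z‖ := by linarith [hR₀ y hy]
  refine ⟨(R₀ + ‖blowupPoint τ z‖) * M, mul_nonneg hR0 hM0, fun t x => ?_⟩
  by_cases hzero : glue T τ z u t x = 0
  · rw [hzero, norm_zero, mul_zero]; exact mul_nonneg hR0 hM0
  obtain ⟨j, hj⟩ := exists_mem_Ico_of_glue_ne_zero z u hzero
  have hσ : (τ⁻¹) ^ (2 * j) * (t - switchTime T τ j) ∈ Icc 0 T :=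
    localTime_mem_Icc h.τ_pos (Ico_subset_Icc_self hj)
  have happ := glue_apply_of_mem_Ico h.T_pos h.τ_pos z u hj x
  -- the preimage point `y = Γ^{-j} x` lies in `G`, for otherwise `𝔲(t, x) = 0`
  have hyG : (1 - τ)⁻¹ • z + (τ⁻¹) ^ j • (x - (1 - τ)⁻¹ • z) ∈ G := by
    by_contra hyG
    exact hzero (by rw [happ, h.apply_eq_zero_of_notMem hσ hyG, smul_zero])
  -- hence `τ^{-j} ‖x - x₀‖ = ‖y - x₀‖ ≤ R`
  have hdist : (τ⁻¹) ^ j * ‖x - blowupPoint τ z‖ ≤ R₀ + ‖blowupPoint τ z‖ := by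
    have e : (1 - τ)⁻¹ • z + (τ⁻¹) ^ j • (x - (1 - τ)⁻¹ • z) - blowupPoint τ z =
        (τ⁻¹) ^ j • (x - blowupPoint τ z) := by
      rw [blowupPoint, add_sub_cancel_left]
    have := hRG _ hyG
    rwa [e, norm_smul, Real.norm_of_nonneg (h.inv_tau_pow_pos j).le] at this
  rw [happ, norm_smul, Real.norm_of_nonneg (h.inv_tau_pow_pos j).le]
  calc ‖x - blowupPoint τ z‖ * ((τ⁻¹) ^ j *
        ‖u ((τ⁻¹) ^ (2 * j) * (t - switchTime T τ j))
          ((1 - τ)⁻¹ • z + (τ⁻¹) ^ j • (x - (1 - τ)⁻¹ • z))‖)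
      = ((τ⁻¹) ^ j * ‖x - blowupPoint τ z‖) *
          ‖u ((τ⁻¹) ^ (2 * j) * (t - switchTime T τ j))
            ((1 - τ)⁻¹ • z + (τ⁻¹) ^ j • (x - (1 - τ)⁻¹ • z))‖ := by ring
    _ ≤ (R₀ + ‖blowupPoint τ z‖) * M :=
        mul_le_mul hdist (hM _ hσ _) (norm_nonneg _) hR0

/-! ### The scale-invariant `L³` norm -/

/-- Change of variables on a piece: `∫ ‖u^{(j)}(s)‖ₑⁿ = τ^{(3-n)j} ∫ ‖u(σ)‖ₑⁿ` in the form
`∫ ‖𝔲(s)‖ₑⁿ = ofReal((τ^{-j})ⁿ (τ^{-j})⁻³) ∫ ‖u(σ)‖ₑⁿ`, `σ` the local time. [folklore] -/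
theorem lintegral_enorm_glue_pow_eq (h : IsNSIBlock T ν₀ τ z G u) {s : ℝ} {j : ℕ}
    (hj : s ∈ Ico (switchTime T τ j) (switchTime T τ (j + 1))) (n : ℕ) :
    ∫⁻ x, ‖glue T τ z u s x‖ₑ ^ n =
      ENNReal.ofReal (((τ⁻¹) ^ j) ^ n * (((τ⁻¹) ^ j) ^ 3)⁻¹) *
        ∫⁻ y, ‖u ((τ⁻¹) ^ (2 * j) * (s - switchTime T τ j)) y‖ₑ ^ n := by
  have hα := h.inv_tau_pow_pos j
  rw [glue_eq_piece h.T_pos h.τ_pos z u hj, piece_slice_eq_smul_comp_affine]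
  have e : ∀ x : EuclideanSpace ℝ (Fin 3), ‖(τ⁻¹) ^ j •
      u ((τ⁻¹) ^ (2 * j) * (s - switchTime T τ j))
        ((1 - (τ⁻¹) ^ j) • (1 - τ)⁻¹ • z + (τ⁻¹) ^ j • x)‖ₑ ^ n =
      ENNReal.ofReal (((τ⁻¹) ^ j) ^ n) *
        ‖u ((τ⁻¹) ^ (2 * j) * (s - switchTime T τ j))
          ((1 - (τ⁻¹) ^ j) • (1 - τ)⁻¹ • z + (τ⁻¹) ^ j • x)‖ₑ ^ n := by
    intro x
    simp only [enorm_smul, mul_pow, Real.enorm_eq_ofReal hα.le, ENNReal.ofReal_pow hα.le]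
  rw [lintegral_congr e,
    lintegral_comp_space_affine hα ((1 - (τ⁻¹) ^ j) • (1 - τ)⁻¹ • z)
      (fun y => ENNReal.ofReal (((τ⁻¹) ^ j) ^ n) *
        ‖u ((τ⁻¹) ^ (2 * j) * (s - switchTime T τ j)) y‖ₑ ^ n),
    lintegral_const_mul' _ _ ENNReal.ofReal_ne_top, ← mul_assoc,
    ← ENNReal.ofReal_mul (by positivity), finrank_euclideanSpace_fin, mul_comm (((τ⁻¹) ^ j) ^ 3)⁻¹]

/-- **The `L³` norm is exactly conserved across the rescalings**: on the `j`-th piece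
`∫ |𝔲(s)|³ = ∫ |u(σ)|³`, `σ = τ^{-2j}(s - t_j) ∈ [0,T)` the local time (the Navier–Stokes
scaling `u ↦ λu(λx, λ²t)` leaves `L³(ℝ³)` invariant). [cite: Ozanski2017NSISingular, §2.1 (p. 7)] -/
theorem lintegral_norm_glue_cube_eq (h : IsNSIBlock T ν₀ τ z G u) {s : ℝ} {j : ℕ}
    (hj : s ∈ Ico (switchTime T τ j) (switchTime T τ (j + 1))) :
    ∫⁻ x, ‖glue T τ z u s x‖ₑ ^ 3 = ∫⁻ y, ‖u ((τ⁻¹) ^ (2 * j) * (s - switchTime T τ j)) y‖ₑ ^ 3 := by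
  rw [h.lintegral_enorm_glue_pow_eq hj 3, mul_inv_cancel₀ (pow_ne_zero _ (h.inv_tau_pow_pos j).ne'),
    ENNReal.ofReal_one, one_mul]

/-- A uniform bound for `∫ |u(t)|ⁿ`, `t ∈ [0,T]` (`|u| ≤ M` on `[0,T] × G`, `u = 0` off `G`).
[folklore] -/
theorem exists_lintegral_pow_bound (h : IsNSIBlock T ν₀ τ z G u) {n : ℕ} (hn : n ≠ 0) :
    ∃ C : ℝ≥0∞, C < ⊤ ∧ ∀ t ∈ Icc 0 T, ∫⁻ x, ‖u t x‖ₑ ^ n ≤ C := by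
  obtain ⟨M, hM0, hM⟩ := h.exists_bound_norm
  refine ⟨ENNReal.ofReal (M ^ n) * volume G,
    ENNReal.mul_lt_top ENNReal.ofReal_lt_top h.isCompact.measure_lt_top, fun t ht => ?_⟩
  calc ∫⁻ x, ‖u t x‖ₑ ^ n ≤ ∫⁻ x, G.indicator (fun _ => ENNReal.ofReal (M ^ n)) x := by
        refine lintegral_mono fun x => ?_
        by_cases hx : x ∈ G
        · rw [indicator_of_mem hx, ← ofReal_norm, ← ENNReal.ofReal_pow (norm_nonneg _)]
          exact ENNReal.ofReal_le_ofReal (pow_le_pow_left₀ (norm_nonneg _) (hM t ht x) n)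
        · simp [h.apply_eq_zero_of_notMem ht hx, hn]
    _ = ENNReal.ofReal (M ^ n) * volume G := lintegral_indicator_const h.isCompact.measurableSet _

/-- **The scale-invariant `L³` norm of the switched field stays bounded up to (and beyond) the
blow-up time**: `sup_s ∫|𝔲(s)|³ ≤ sup_{[0,T]} ∫|u|³ < ∞` (Ożański 2017, §2.1, p. 7: "the `L³`
norm of `𝔲(t)` remains bounded … This shows that the `L_{3,∞}` regularity criterion uses, in an
essential way, properties of solutions of the Navier–Stokes equations (rather than merely the
Navier–Stokes inequality)"). [cite: Ozanski2017NSISingular, §2.1 (p. 7)] -/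
theorem lintegral_norm_glue_cube_le (h : IsNSIBlock T ν₀ τ z G u) :
    ∃ C : ℝ≥0∞, C < ⊤ ∧ ∀ s : ℝ, ∫⁻ x, ‖glue T τ z u s x‖ₑ ^ 3 ≤ C := by
  obtain ⟨C, hC, hE⟩ := h.exists_lintegral_pow_bound (n := 3) (by norm_num)
  refine ⟨C, hC, fun s => ?_⟩
  by_cases hs : s ∈ Ico 0 (blowupTime T τ)
  · obtain ⟨j, hj⟩ := exists_mem_Ico_switchTime h.τ_pos h.τ_lt_one hs.1 hs.2
    rw [h.lintegral_norm_glue_cube_eq hj]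
    exact hE _ (localTime_mem_Icc h.τ_pos (Ico_subset_Icc_self hj))
  · rw [h.glue_eq_zero_of_notMem hs]
    simp

/-! ### The energy jump at the first switching time -/

/-- **The energy right after the first switch**: `∫|𝔲(T)|² = τ ∫|u(0)|²`
(`𝔲(T) = u^{(1)}(t₁) = τ⁻¹ u(0, Γ⁻¹·)`). [cite: Ozanski2017NSISingular, §2 (2.4) and p. 7] -/
theorem lintegral_norm_sq_glue_T (h : IsNSIBlock T ν₀ τ z G u) :
    ∫⁻ x, ‖glue T τ z u T x‖ₑ ^ 2 = ENNReal.ofReal τ * ∫⁻ y, ‖u 0 y‖ₑ ^ 2 := by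
  have hj : T ∈ Ico (switchTime T τ 1) (switchTime T τ (1 + 1)) := by
    refine ⟨by rw [switchTime_one], ?_⟩
    have := strictMono_switchTime h.T_pos h.τ_pos (show 1 < 1 + 1 by norm_num)
    rwa [switchTime_one] at this
  rw [h.lintegral_enorm_glue_pow_eq hj 2, switchTime_one, sub_self, mul_zero]
  congr 2
  have hτ : τ ≠ 0 := h.τ_pos.ne'
  rw [pow_one, inv_pow, inv_pow, inv_inv]
  field_simp

/-- **The gain transported to energies**: `τ ∫|u(0)|² ≤ ∫_{Γ(G)} |u(T)|²` (integrate the gain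
(2.2) `|u(Γx, T)| ≥ τ⁻¹|u(x, 0)|` over `G ⊇ supp u(0)` and change variables, `|det Γ| = τ³`).
[cite: Ozanski2017NSISingular, §2 (2.2)] -/
theorem ofReal_tau_mul_lintegral_le (h : IsNSIBlock T ν₀ τ z G u) :
    ENNReal.ofReal τ * ∫⁻ y, ‖u 0 y‖ₑ ^ 2 ≤
      ∫⁻ x in (fun y : EuclideanSpace ℝ (Fin 3) => τ • y + z) '' G, ‖u T x‖ₑ ^ 2 := by
  have hτ := h.τ_pos
  have hT : T ∈ Icc 0 T := ⟨h.T_pos.le, le_rfl⟩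
  have h0 : (0 : ℝ) ∈ Icc 0 T := ⟨le_rfl, h.T_pos.le⟩
  set Γ : EuclideanSpace ℝ (Fin 3) → EuclideanSpace ℝ (Fin 3) := fun y => τ • y + z with hΓ
  have hΓ' : (fun y : EuclideanSpace ℝ (Fin 3) => z + τ • y) = Γ := by
    funext y; rw [hΓ]; exact add_comm _ _
  have hinj : Injective Γ := fun a b hab => by
    have : τ • a = τ • b := add_right_cancel hab
    exact smul_right_injective _ hτ.ne' this
  -- change of variables on the right-hand side
  have hcv := setLIntegral_preimage_comp_space_affine hτ z (fun x => ‖u T x‖ₑ ^ 2) (Γ '' G)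
  rw [hΓ', hinj.preimage_image, finrank_euclideanSpace_fin] at hcv
  -- `∫_G |u(T)(Γ y)|² dy = (τ³)⁻¹ ∫_{Γ G} |u(T)|²`
  have hpos3 : 0 < τ ^ 3 := pow_pos hτ 3
  have hcv' : ∫⁻ x in Γ '' G, ‖u T x‖ₑ ^ 2 =
      ENNReal.ofReal (τ ^ 3) * ∫⁻ y in G, ‖u T (z + τ • y)‖ₑ ^ 2 := by
    rw [hcv, ← mul_assoc, ← ENNReal.ofReal_mul hpos3.le, mul_inv_cancel₀ hpos3.ne',
      ENNReal.ofReal_one, one_mul]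
  rw [hcv']
  -- the gain, pointwise: `τ⁻² |u(0,y)|² ≤ |u(T, Γ y)|²`
  have hgain : ∀ y, ENNReal.ofReal (τ⁻¹ ^ 2) * ‖u 0 y‖ₑ ^ 2 ≤ ‖u T (z + τ • y)‖ₑ ^ 2 := by
    intro y
    have hg := h.gain y
    rw [add_comm (τ • y) z] at hg
    have h1 : (τ⁻¹ * ‖u 0 y‖) ^ 2 ≤ ‖u T (z + τ • y)‖ ^ 2 :=
      pow_le_pow_left₀ (by positivity) hg 2
    rw [← ofReal_norm, ← ofReal_norm, ← ENNReal.ofReal_pow (norm_nonneg _),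
      ← ENNReal.ofReal_pow (norm_nonneg _), ← ENNReal.ofReal_mul (by positivity), ← mul_pow]
    exact ENNReal.ofReal_le_ofReal h1
  -- `u(0)` vanishes off `G`
  have hsupp : ∫⁻ y, ‖u 0 y‖ₑ ^ 2 = ∫⁻ y in G, ‖u 0 y‖ₑ ^ 2 := by
    rw [← lintegral_indicator h.isCompact.measurableSet]
    refine lintegral_congr fun y => ?_
    by_cases hy : y ∈ G
    · rw [indicator_of_mem hy]
    · simp [indicator_of_notMem hy, h.apply_eq_zero_of_notMem h0 hy]
  calc ENNReal.ofReal τ * ∫⁻ y, ‖u 0 y‖ₑ ^ 2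
      = ENNReal.ofReal (τ ^ 3) * (ENNReal.ofReal (τ⁻¹ ^ 2) * ∫⁻ y in G, ‖u 0 y‖ₑ ^ 2) := by
        rw [hsupp, ← mul_assoc, ← ENNReal.ofReal_mul hpos3.le]
        congr 2
        field_simp
    _ = ENNReal.ofReal (τ ^ 3) * ∫⁻ y in G, ENNReal.ofReal (τ⁻¹ ^ 2) * ‖u 0 y‖ₑ ^ 2 := by
        rw [lintegral_const_mul' _ _ ENNReal.ofReal_ne_top]
    _ ≤ ENNReal.ofReal (τ ^ 3) * ∫⁻ y in G, ‖u T (z + τ • y)‖ₑ ^ 2 := by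
        gcongr with y
        exact hgain y

/-- **`Γ(G)` misses a nonempty open part of `supp u(T)`**: there is a point where `u(T) ≠ 0`
outside `Γ(G)` (the point of `G` farthest from the centre `x₀` is not in `Γ(G) = x₀ + τ(G - x₀)`
unless `G = {x₀}`, which is excluded by `u(0) ≢ 0`; and `G = closure {u(T) ≠ 0}`). [folklore] -/
theorem exists_apply_T_ne_zero_notMem_image (h : IsNSIBlock T ν₀ τ z G u) :
    ∃ w : EuclideanSpace ℝ (Fin 3), u T w ≠ 0 ∧
      w ∉ (fun y : EuclideanSpace ℝ (Fin 3) => τ • y + z) '' G := by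
  have hT : T ∈ Icc 0 T := ⟨h.T_pos.le, le_rfl⟩
  have h0 : (0 : ℝ) ∈ Icc 0 T := ⟨le_rfl, h.T_pos.le⟩
  -- the farthest point of `G` from `x₀`
  have hcont : ContinuousOn (fun y : EuclideanSpace ℝ (Fin 3) => ‖y - blowupPoint τ z‖) G :=
    (continuous_id.sub continuous_const).norm.continuousOn
  obtain ⟨ys, hysG, hys⟩ := h.isCompact.exists_isMaxOn h.nonempty hcont
  -- it is not in `Γ(G)`
  have hys_not : ys ∉ (fun y : EuclideanSpace ℝ (Fin 3) => τ • y + z) '' G := by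
    rintro ⟨y', hy'G, hy'⟩
    have e : ys - blowupPoint τ z = τ • (y' - blowupPoint τ z) := by
      rw [← hy']
      show τ • y' + z - blowupPoint τ z = τ • (y' - blowupPoint τ z)
      rw [blowupPoint, similarity_eq h.τ_lt_one.ne z y', add_sub_cancel_left]
    have hle : ‖y' - blowupPoint τ z‖ ≤ ‖ys - blowupPoint τ z‖ := hys hy'G
    have hn : ‖ys - blowupPoint τ z‖ = τ * ‖y' - blowupPoint τ z‖ := by
      rw [e, norm_smul, Real.norm_of_nonneg h.τ_pos.le]
    -- hence `‖ys - x₀‖ = 0`, so `G ⊆ {x₀}`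
    have hzero : ‖ys - blowupPoint τ z‖ = 0 := by
      nlinarith [norm_nonneg (ys - blowupPoint τ z), norm_nonneg (y' - blowupPoint τ z),
        h.τ_lt_one, h.τ_pos]
    have hG : G ⊆ {blowupPoint τ z} := fun y hy => by
      have := (hys hy).trans hzero.le
      exact mem_singleton_iff.2 (sub_eq_zero.1 (norm_le_zero_iff.1 this))
    -- but `G ⊇ {u(0) ≠ 0}`, a nonempty open set: it contains a ball, of positive measure
    obtain ⟨xs, hxs⟩ := h.nontrivial
    have hopen : IsOpen (support (u 0)) := (h.contDiff_slice h0).continuous.isOpen_support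
    obtain ⟨ε, hε, hball⟩ := Metric.isOpen_iff.1 hopen xs (mem_support.2 hxs)
    have hsub : support (u 0) ⊆ G := by
      rw [← h.tsupport_eq 0 h0]; exact subset_tsupport _
    have hvol : volume (ball xs ε) ≤ volume ({blowupPoint τ z} : Set (EuclideanSpace ℝ (Fin 3))) :=
      measure_mono ((hball.trans hsub).trans hG)
    rw [measure_singleton, nonpos_iff_eq_zero] at hvol
    exact (measure_ball_pos volume xs hε).ne' hvol
  -- `ys ∈ G = closure {u(T) ≠ 0}` and `Γ(G)ᶜ` is an open neighbourhood of `ys`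
  have hclosed : IsClosed ((fun y : EuclideanSpace ℝ (Fin 3) => τ • y + z) '' G) :=
    (h.isCompact.image (by fun_prop)).isClosed
  have hysT : ys ∈ closure (support (u T)) := by
    have := h.tsupport_eq T hT
    rw [tsupport] at this
    rw [this]; exact hysG
  obtain ⟨w, hwO, hwsupp⟩ := mem_closure_iff.1 hysT _ hclosed.isOpen_compl hys_not
  exact ⟨w, mem_support.1 hwsupp, hwO⟩

/-- **The energy jumps down at the first switching time**: `τ ∫|u(0)|² < ∫|u(T)|²`, i.e.
`‖𝔲(T)‖²_{L²} < ‖u(T)‖²_{L²} = lim_{t ↑ T} ‖𝔲(t)‖²_{L²}` — the drop (2.6) is strict on the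
nonempty open set `{u(T) ≠ 0} ∖ Γ(G)`. [cite: Ozanski2017NSISingular, §2 (2.6) and §2.1 (p. 7)] -/
theorem lintegral_norm_sq_glue_T_lt (h : IsNSIBlock T ν₀ τ z G u) :
    ∫⁻ x, ‖glue T τ z u T x‖ₑ ^ 2 < ∫⁻ x, ‖u T x‖ₑ ^ 2 := by
  have hT : T ∈ Icc 0 T := ⟨h.T_pos.le, le_rfl⟩
  set S : Set (EuclideanSpace ℝ (Fin 3)) := (fun y : EuclideanSpace ℝ (Fin 3) => τ • y + z) '' G with hS
  have hSmeas : MeasurableSet S := (h.isCompact.image (by fun_prop)).measurableSet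
  rw [h.lintegral_norm_sq_glue_T]
  -- finiteness of the first summand
  obtain ⟨C, hC, hE⟩ := h.exists_energy_bound
  have hfin : ∫⁻ x in S, ‖u T x‖ₑ ^ 2 ≠ ⊤ :=
    ((setLIntegral_le_lintegral S _).trans (hE T hT)).trans_lt hC |>.ne
  -- positivity of the second summand: `{u(T) ≠ 0} ∖ S` is a nonempty open set
  have hpos : ∫⁻ x in Sᶜ, ‖u T x‖ₑ ^ 2 ≠ 0 := by
    obtain ⟨w, hw, hwS⟩ := h.exists_apply_T_ne_zero_notMem_image
    have hcont : Continuous (u T) := (h.contDiff_slice hT).continuous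
    have hopen : IsOpen (support (u T) ∩ Sᶜ) :=
      hcont.isOpen_support.inter (h.isCompact.image (by fun_prop)).isClosed.isOpen_compl
    have hvol : 0 < volume (support (u T) ∩ Sᶜ) :=
      hopen.measure_pos volume ⟨w, mem_support.2 hw, hwS⟩
    intro hzero
    have hle : ∫⁻ x in support (u T) ∩ Sᶜ, ‖u T x‖ₑ ^ 2 ≤ ∫⁻ x in Sᶜ, ‖u T x‖ₑ ^ 2 :=
      lintegral_mono_set inter_subset_right
    rw [hzero, nonpos_iff_eq_zero] at hle
    have hmeas : Measurable fun x => ‖u T x‖ₑ ^ 2 := hcont.measurable.enorm.pow_const 2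
    rw [lintegral_eq_zero_iff hmeas] at hle
    -- a.e. zero on a set of positive measure where it is pointwise nonzero: contradiction
    have hae : ∀ᵐ x ∂(volume.restrict (support (u T) ∩ Sᶜ)), x ∈ support (u T) ∩ Sᶜ :=
      ae_restrict_mem (hcont.isOpen_support.measurableSet.inter hSmeas.compl)
    have hfalse : ∀ᵐ x ∂(volume.restrict (support (u T) ∩ Sᶜ)), False := by
      filter_upwards [hle, hae] with x hx hxmem
      have hne : u T x ≠ 0 := mem_support.1 hxmem.1
      simp only [Pi.zero_apply, pow_eq_zero_iff, ne_eq, OfNat.ofNat_ne_zero, not_false_eq_true,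
        enorm_eq_zero] at hx
      exact hne hx
    rw [eventually_false_iff_eq_bot, ae_eq_bot, Measure.restrict_eq_zero] at hfalse
    exact hvol.ne' hfalse
  calc ENNReal.ofReal τ * ∫⁻ y, ‖u 0 y‖ₑ ^ 2 ≤ ∫⁻ x in S, ‖u T x‖ₑ ^ 2 := h.ofReal_tau_mul_lintegral_le
    _ < (∫⁻ x in S, ‖u T x‖ₑ ^ 2) + ∫⁻ x in Sᶜ, ‖u T x‖ₑ ^ 2 := ENNReal.lt_add_right hfin hpos
    _ = ∫⁻ x, ‖u T x‖ₑ ^ 2 := lintegral_add_compl (fun x => ‖u T x‖ₑ ^ 2) hSmeas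

/-- **The energy of the switched field tends to `∫|u(T)|²` as `t ↑ T`** (`𝔲 = u` on `[0,T)` and
`u` is jointly continuous and uniformly bounded with support in `G`; dominated convergence).
[cite: Ozanski2017NSISingular, §2 (2.4)] -/
theorem tendsto_lintegral_norm_sq_glue_left (h : IsNSIBlock T ν₀ τ z G u) :
    Tendsto (fun t => ∫⁻ x, ‖glue T τ z u t x‖ₑ ^ 2) (𝓝[<] T) (𝓝 (∫⁻ x, ‖u T x‖ₑ ^ 2)) := by
  obtain ⟨M, hM0, hM⟩ := h.exists_bound_norm
  have hT : T ∈ Icc 0 T := ⟨h.T_pos.le, le_rfl⟩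
  have hIoo : Ioo 0 T ∈ 𝓝[<] T := Ioo_mem_nhdsLT h.T_pos
  -- on `(0, T)` the glued field is `u`
  have heq : ∀ᶠ t in 𝓝[<] T, ∫⁻ x, ‖glue T τ z u t x‖ₑ ^ 2 = ∫⁻ x, ‖u t x‖ₑ ^ 2 := by
    filter_upwards [hIoo] with t ht
    rw [glue_eq_of_mem_Ico h.T_pos h.τ_pos z u ⟨ht.1.le, ht.2⟩]
  refine (tendsto_congr' heq).2 ?_
  refine tendsto_lintegral_filter_of_dominated_convergence
    (G.indicator fun _ => ENNReal.ofReal (M ^ 2)) ?_ ?_ ?_ ?_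
  · filter_upwards [hIoo] with t ht
    exact (h.contDiff_slice ⟨ht.1.le, ht.2.le⟩).continuous.measurable.enorm.pow_const 2
  · filter_upwards [hIoo] with t ht
    refine Eventually.of_forall fun x => ?_
    by_cases hx : x ∈ G
    · rw [indicator_of_mem hx, ← ofReal_norm, ← ENNReal.ofReal_pow (norm_nonneg _)]
      exact ENNReal.ofReal_le_ofReal (pow_le_pow_left₀ (norm_nonneg _) (hM t ⟨ht.1.le, ht.2.le⟩ x) 2)
    · simp [h.apply_eq_zero_of_notMem ⟨ht.1.le, ht.2.le⟩ hx]
  · rw [lintegral_indicator_const h.isCompact.measurableSet]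
    exact (ENNReal.mul_lt_top ENNReal.ofReal_lt_top h.isCompact.measure_lt_top).ne
  · refine Eventually.of_forall fun x => ?_
    -- pointwise continuity in time at `T` from the left, from joint continuity on `[0,T] × ℝ³`
    have hcw : ContinuousWithinAt (uncurry u) (Icc 0 T ×ˢ univ) (T, x) :=
      h.continuousOn_uncurry (T, x) ⟨hT, mem_univ _⟩
    have hpath : Tendsto (fun t : ℝ => ((t, x) : ℝ × EuclideanSpace ℝ (Fin 3))) (𝓝[<] T)
        (𝓝[Icc 0 T ×ˢ univ] ((T, x) : ℝ × EuclideanSpace ℝ (Fin 3))) := by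
      refine tendsto_nhdsWithin_iff.2 ⟨?_, ?_⟩
      · exact ((continuous_id.prodMk continuous_const).tendsto T).mono_left nhdsWithin_le_nhds
      · filter_upwards [hIoo] with t ht
        exact ⟨⟨ht.1.le, ht.2.le⟩, mem_univ _⟩
    have hux : Tendsto (fun t => u t x) (𝓝[<] T) (𝓝 (u T x)) := hcw.tendsto.comp hpath
    exact ENNReal.Tendsto.pow hux.enorm

/-- **The energy of Scheffer's switched field is not left-continuous at the first switching
time `T`** (so `𝔲 ∉ C([0,T₀); L²)`): it tends to `∫|u(T)|²` from the left but equals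
`τ∫|u(0)|² < ∫|u(T)|²` at `T`. The switching mechanism therefore never produces time-continuous
(Leray–Hopf-like) fields; the implicit force `f = ∂ₜ𝔲 - νΔ𝔲 + (𝔲·∇)𝔲 + ∇p` has atoms at the
switching times. [cite: Ozanski2017NSISingular, §2 (2.6) and §2.1 (p. 7)] -/
theorem not_continuousWithinAt_energy_glue (h : IsNSIBlock T ν₀ τ z G u) :
    ¬ ContinuousWithinAt (fun t => ∫⁻ x, ‖glue T τ z u t x‖ₑ ^ 2) (Iio T) T := by
  intro hc
  have h1 := h.tendsto_lintegral_norm_sq_glue_left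
  have h2 : Tendsto (fun t => ∫⁻ x, ‖glue T τ z u t x‖ₑ ^ 2) (𝓝[<] T)
      (𝓝 (∫⁻ x, ‖glue T τ z u T x‖ₑ ^ 2)) := hc.tendsto
  have := tendsto_nhds_unique h2 h1
  exact (h.lintegral_norm_sq_glue_T_lt).ne this

end IsNSIBlock

end Literature.Barriers.NavierStokesRegularity

end
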